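import Summits.RiemannHypothesis.RiemannHypothesis.Theorems.PfPersistenceGalerkinFormMellin
import Literature.Analysis.SpecialFunctions.DigammaLogBound
import Mathlib.Analysis.SpecialFunctions.JapaneseBracket
import Mathlib.MeasureTheory.Integral.IntervalIntegral.IntegrationByParts
import HarnessLib

/-!
# PF persistence — GAL-0 piece (ii), STEP 3b: decay of the transform of the cut-off Galerkin
# profile and integrability of its archimedean integrand (pub-rhpf barrier-prover g2)

HONEST FRAMING: long-odds mechanism search; no RH claims.  Continues
`Theorems/PfPersistenceGalerkinFormMellin.lean` (STEP 3a: `(G ⋆ G̃)^(½+it) = |Ĝ(½+it)|²` for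
integrable `G`).  Here `G = cutoffProfile win v = 1_{[-a,a]}·θ_v` with `θ_v` a (globally smooth)
cosine polynomial, and we prove the one estimate of the piece-(ii) proof plan that is not in the
tree:

* `norm_intervalIntegral_mul_cexp_le` — ONE INTEGRATION BY PARTS: for `f` with a continuous
  derivative on `[a, b]` and `t ≠ 0`,
  `‖∫_a^b f(x) e^{itx} dx‖ ≤ (‖f a‖ + ‖f b‖ + ∫_a^b ‖f'‖) / |t|`;
* `weilMellin_cutoffProfile_half_eq` — `Ĝ(½+it) = ∫_{-a}^{a} θ_v(x) e^{itx} dx`;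
* `exists_norm_weilMellin_cutoffProfile_half_le` — `‖Ĝ(½+it)‖ ≤ C_v / (1 + |t|)` for all `t`
  (the jump of `G` at `±a` costs exactly one power of `t`);
* `continuous_weilMellin_cutoffProfile_half` — `t ↦ Ĝ(½+it)` is continuous;
* `integrable_weilArchIntegrand_cutoffProfile` — the archimedean integrand
  `t ↦ (G ⋆ G̃)^(½+it) · Re ψ(¼ + it/2)` of `weilArchIntegral (G ⋆ G̃)` is INTEGRABLE
  (`|Ĝ|² ≤ C²/(1+|t|)²` against `‖ψ(¼+it/2)‖ ≤ C' + log(1+|t|)`,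
  `Literature.Analysis.SpecialFunctions.Complex.exists_norm_digamma_vertical_le`), i.e. the
  hypothesis `hA` of `Literature.NumberTheory.LFunctions.WeilContinuous.tendsto_weilFunctional_moll`
  for the autocorrelation of the cut-off profile — so `Re Q(cutoffProfile win v)` is a genuine
  (absolutely convergent) number and the mollification engine of `WeilExplicitContinuous` applies
  to it once continuity of `G ⋆ G̃` is supplied (STEP 2 of the plan).

RH-free, no data, no named facts.
-/

set_option linter.dupNamespace false

noncomputable section

open Complex Filter Set MeasureTheory Matrix intervalIntegral
open scoped Real Topology ComplexConjugate

namespace Summit.RiemannHypothesis.RiemannHypothesis.Theorems.PfPersistence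

open Literature.NumberTheory.LFunctions

/-! ## §1 One integration by parts against `e^{itx}` -/

/-- The oscillatory factor `x ↦ e^{itx}`. [folklore] -/
def oscFactor (t : ℝ) (x : ℝ) : ℂ := cexp (t * I * x)

/-- `‖e^{itx}‖ = 1`. [folklore] -/
theorem norm_oscFactor (t x : ℝ) : ‖oscFactor t x‖ = 1 := by
  rw [oscFactor, show (t : ℂ) * I * (x : ℂ) = ((t * x : ℝ) : ℂ) * I by push_cast; ring]
  exact Complex.norm_exp_ofReal_mul_I _

/-- `d/dx e^{itx} = (it) e^{itx}`. [folklore] -/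
theorem hasDerivAt_oscFactor (t x : ℝ) :
    HasDerivAt (oscFactor t) (t * I * oscFactor t x) x := by
  have h1 : HasDerivAt (fun y : ℝ ↦ (t : ℂ) * I * (y : ℂ)) (t * I * 1) x :=
    (Complex.ofRealCLM.hasDerivAt.const_mul (t * I : ℂ)).congr_deriv (by simp)
  have h2 := h1.cexp
  simp only [mul_one] at h2
  refine h2.congr_deriv ?_
  rw [oscFactor]; ring

/-- The oscillatory factor is continuous (jointly in `(t, x)`). [folklore] -/
theorem continuous_oscFactor_uncurry : Continuous fun p : ℝ × ℝ ↦ oscFactor p.1 p.2 := by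
  unfold oscFactor; fun_prop

/-- The primitive `x ↦ e^{itx}/(it)` has derivative `e^{itx}` for `t ≠ 0`. [folklore] -/
theorem hasDerivAt_oscFactor_div {t : ℝ} (ht : t ≠ 0) (x : ℝ) :
    HasDerivAt (fun y ↦ oscFactor t y / (t * I)) (oscFactor t x) x := by
  have htI : (t : ℂ) * I ≠ 0 := mul_ne_zero (by exact_mod_cast ht) Complex.I_ne_zero
  have h := (hasDerivAt_oscFactor t x).div_const (t * I : ℂ)
  refine h.congr_deriv ?_
  exact mul_div_cancel_left₀ _ htI

/-- **Integration by parts against `e^{itx}`**: for `f` differentiable on `[a, b]` with a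
continuous derivative and `t ≠ 0`,
`‖∫_a^b f(x) e^{itx} dx‖ ≤ (‖f a‖ + ‖f b‖ + ∫_a^b ‖f'(x)‖ dx) / |t|`. [folklore] -/
theorem norm_intervalIntegral_mul_cexp_le {f f' : ℝ → ℂ} {a b : ℝ} (hab : a ≤ b)
    (hf : ∀ x ∈ uIcc a b, HasDerivAt f (f' x) x) (hf' : Continuous f') {t : ℝ} (ht : t ≠ 0) :
    ‖∫ x in a..b, f x * oscFactor t x‖ ≤ (‖f a‖ + ‖f b‖ + ∫ x in a..b, ‖f' x‖) / |t| := by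
  have htI : (t : ℂ) * I ≠ 0 := mul_ne_zero (by exact_mod_cast ht) Complex.I_ne_zero
  have hnorm_tI : ‖(t : ℂ) * I‖ = |t| := by
    rw [norm_mul, Complex.norm_I, mul_one, Complex.norm_real, Real.norm_eq_abs]
  have hv : ∀ x ∈ uIcc a b, HasDerivAt (fun y ↦ oscFactor t y / (t * I)) (oscFactor t x) x :=
    fun x _ ↦ hasDerivAt_oscFactor_div ht x
  have hcont_osc : Continuous (oscFactor t) := by unfold oscFactor; fun_prop
  have hIBP := integral_mul_deriv_eq_deriv_mul hf hv (hf'.intervalIntegrable _ _)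
    (hcont_osc.intervalIntegrable _ _)
  rw [hIBP]
  have hvnorm : ∀ x, ‖oscFactor t x / (t * I)‖ = 1 / |t| := by
    intro x; rw [norm_div, norm_oscFactor, hnorm_tI]
  have h1 : ‖f b * (oscFactor t b / (t * I))‖ = ‖f b‖ / |t| := by
    rw [norm_mul, hvnorm]; ring
  have h2 : ‖f a * (oscFactor t a / (t * I))‖ = ‖f a‖ / |t| := by
    rw [norm_mul, hvnorm]; ring
  have h3 : ‖∫ x in a..b, f' x * (oscFactor t x / (t * I))‖ ≤ (∫ x in a..b, ‖f' x‖) / |t| := by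
    have hle : ‖∫ x in a..b, f' x * (oscFactor t x / (t * I))‖ ≤
        ∫ x in a..b, ‖f' x * (oscFactor t x / (t * I))‖ :=
      intervalIntegral.norm_integral_le_integral_norm hab
    have heq : (fun x ↦ ‖f' x * (oscFactor t x / (t * I))‖) = fun x ↦ ‖f' x‖ * (1 / |t|) := by
      funext x; rw [norm_mul, hvnorm]
    rw [heq, intervalIntegral.integral_mul_const] at hle
    simpa only [mul_one_div] using hle
  have htpos : 0 < |t| := abs_pos.2 ht
  calc ‖f b * (oscFactor t b / (t * I)) - f a * (oscFactor t a / (t * I)) -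
          ∫ x in a..b, f' x * (oscFactor t x / (t * I))‖
      ≤ ‖f b * (oscFactor t b / (t * I))‖ + ‖f a * (oscFactor t a / (t * I))‖ +
          ‖∫ x in a..b, f' x * (oscFactor t x / (t * I))‖ := by
        refine (norm_sub_le _ _).trans ?_
        gcongr
        exact norm_sub_le _ _
    _ ≤ ‖f b‖ / |t| + ‖f a‖ / |t| + (∫ x in a..b, ‖f' x‖) / |t| := by rw [h1, h2]; gcongr
    _ = (‖f a‖ + ‖f b‖ + ∫ x in a..b, ‖f' x‖) / |t| := by ring

/-- The trivial bound `‖∫_a^b f e^{itx}‖ ≤ ∫_a^b ‖f‖`. [folklore] -/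
theorem norm_intervalIntegral_mul_cexp_le_integral_norm {f : ℝ → ℂ} {a b : ℝ} (hab : a ≤ b)
    (t : ℝ) : ‖∫ x in a..b, f x * oscFactor t x‖ ≤ ∫ x in a..b, ‖f x‖ := by
  refine (intervalIntegral.norm_integral_le_integral_norm hab).trans_eq ?_
  congr 1 with x
  rw [norm_mul, norm_oscFactor, mul_one]

/-! ## §2 The Galerkin profile is smooth -/

/-- Connes' even modes are smooth. [folklore] -/
theorem contDiff_xiEven (L : ℝ) (n : ℕ) : ContDiff ℝ ⊤ (fun x ↦ xiEven L n x) := by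
  by_cases hn : n = 0
  · simp only [xiEven, hn, if_true]; exact contDiff_const
  · simp only [xiEven, hn, if_false]; fun_prop

/-- Galerkin profiles are smooth (finite cosine sums). [folklore] -/
theorem contDiff_profile (L : ℝ) {N : ℕ} (v : Fin (N + 1) → ℝ) :
    ContDiff ℝ ⊤ (fun x ↦ profile L v x) := by
  unfold profile
  exact ContDiff.sum fun n _ ↦ contDiff_const.mul (contDiff_xiEven L n)

/-- The profile as a complex-valued function. [folklore] -/
def profileC (L : ℝ) {N : ℕ} (v : Fin (N + 1) → ℝ) (x : ℝ) : ℂ := (profile L v x : ℂ)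

/-- The complex profile is differentiable with derivative `(θ_v')`. [folklore] -/
theorem hasDerivAt_profileC (L : ℝ) {N : ℕ} (v : Fin (N + 1) → ℝ) (x : ℝ) :
    HasDerivAt (profileC L v) ((deriv (fun y ↦ profile L v y) x : ℝ) : ℂ) x := by
  have hd : DifferentiableAt ℝ (fun y ↦ profile L v y) x :=
    ((contDiff_profile L v).differentiable (by simp)).differentiableAt
  exact hd.hasDerivAt.ofReal_comp

/-- The derivative of the complex profile is continuous. [folklore] -/
theorem continuous_deriv_profileC (L : ℝ) {N : ℕ} (v : Fin (N + 1) → ℝ) :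
    Continuous fun x ↦ ((deriv (fun y ↦ profile L v y) x : ℝ) : ℂ) :=
  continuous_ofReal.comp ((contDiff_profile L v).continuous_deriv (by simp))

/-- The complex profile is continuous. [folklore] -/
theorem continuous_profileC (L : ℝ) {N : ℕ} (v : Fin (N + 1) → ℝ) : Continuous (profileC L v) :=
  continuous_ofReal.comp (CentralMassFloor.continuous_profile L v)

/-! ## §3 The transform of the cut-off profile on the critical line -/

/-- `Ĝ(½ + it) = ∫_{-a}^{a} θ_v(x) e^{itx} dx` for the cut-off profile. [folklore] -/
theorem weilMellin_cutoffProfile_half_eq (win : Window) (v : Fin (win.N + 1) → ℝ) (t : ℝ) :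
    weilMellin (cutoffProfile win v) (1 / 2 + t * I) =
      ∫ x in (-win.a)..win.a, profileC (2 * win.a) v x * oscFactor t x := by
  have ha : -win.a ≤ win.a := by linarith [win.ha]
  unfold weilMellin
  have hpt : (fun x : ℝ ↦ cutoffProfile win v x * cexp ((1 / 2 + t * I - 1 / 2) * x)) =
      (Icc (-win.a) win.a).indicator (fun x ↦ profileC (2 * win.a) v x * oscFactor t x) := by
    funext x
    by_cases hx : x ∈ Icc (-win.a) win.a
    · rw [indicator_of_mem hx]
      simp only [cutoffProfile, indicator_of_mem hx, profileC, oscFactor]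
      congr 1; ring_nf
    · rw [indicator_of_notMem hx]
      simp [cutoffProfile, indicator_of_notMem hx]
  rw [hpt, MeasureTheory.integral_indicator measurableSet_Icc, integral_Icc_eq_integral_Ioc,
    ← intervalIntegral.integral_of_le ha]

/-- **Decay**: `‖Ĝ(½+it)‖ ≤ C / (1 + |t|)` for the cut-off Galerkin profile. [folklore] -/
theorem exists_norm_weilMellin_cutoffProfile_half_le (win : Window) (v : Fin (win.N + 1) → ℝ) :
    ∃ C : ℝ, 0 ≤ C ∧ ∀ t : ℝ,
      ‖weilMellin (cutoffProfile win v) (1 / 2 + t * I)‖ ≤ C / (1 + |t|) := by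
  have ha : -win.a ≤ win.a := by linarith [win.ha]
  set θ := profileC (2 * win.a) v with hθ
  set θ' : ℝ → ℂ := fun x ↦ ((deriv (fun y ↦ profile (2 * win.a) v y) x : ℝ) : ℂ) with hθ'
  set C₀ : ℝ := ∫ x in (-win.a)..win.a, ‖θ x‖ with hC₀
  set C₁ : ℝ := ‖θ (-win.a)‖ + ‖θ win.a‖ + ∫ x in (-win.a)..win.a, ‖θ' x‖ with hC₁
  have hC₀nn : 0 ≤ C₀ := intervalIntegral.integral_nonneg ha fun x _ ↦ norm_nonneg _
  have hC₁nn : 0 ≤ C₁ := by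
    have : 0 ≤ ∫ x in (-win.a)..win.a, ‖θ' x‖ :=
      intervalIntegral.integral_nonneg ha fun x _ ↦ norm_nonneg _
    positivity
  refine ⟨2 * max C₀ C₁, by positivity, fun t ↦ ?_⟩
  rw [weilMellin_cutoffProfile_half_eq]
  have h0 : ‖∫ x in (-win.a)..win.a, θ x * oscFactor t x‖ ≤ C₀ :=
    norm_intervalIntegral_mul_cexp_le_integral_norm ha t
  have hpos : 0 < 1 + |t| := by positivity
  rw [le_div_iff₀ hpos]
  by_cases ht : |t| ≤ 1
  · calc ‖∫ x in (-win.a)..win.a, θ x * oscFactor t x‖ * (1 + |t|) ≤ C₀ * 2 := by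
          refine mul_le_mul h0 (by linarith) hpos.le hC₀nn
      _ ≤ 2 * max C₀ C₁ := by linarith [le_max_left C₀ C₁]
  · push Not at ht
    have ht0 : t ≠ 0 := by intro h; rw [h, abs_zero] at ht; linarith
    have h1 : ‖∫ x in (-win.a)..win.a, θ x * oscFactor t x‖ ≤ C₁ / |t| :=
      norm_intervalIntegral_mul_cexp_le ha (fun x _ ↦ hasDerivAt_profileC _ v x)
        (continuous_deriv_profileC _ v) ht0
    have htpos : 0 < |t| := by linarith
    calc ‖∫ x in (-win.a)..win.a, θ x * oscFactor t x‖ * (1 + |t|)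
        ≤ C₁ / |t| * (1 + |t|) := by gcongr
      _ = C₁ * ((1 + |t|) / |t|) := by ring
      _ ≤ C₁ * 2 := by
          refine mul_le_mul_of_nonneg_left ?_ hC₁nn
          rw [div_le_iff₀ htpos]; linarith
      _ ≤ 2 * max C₀ C₁ := by linarith [le_max_right C₀ C₁]

/-- `t ↦ Ĝ(½+it)` is continuous. [folklore] -/
theorem continuous_weilMellin_cutoffProfile_half (win : Window) (v : Fin (win.N + 1) → ℝ) :
    Continuous fun t : ℝ ↦ weilMellin (cutoffProfile win v) (1 / 2 + t * I) := by
  have heq : (fun t : ℝ ↦ weilMellin (cutoffProfile win v) (1 / 2 + t * I)) =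
      fun t ↦ ∫ x in (-win.a)..win.a, profileC (2 * win.a) v x * oscFactor t x :=
    funext (weilMellin_cutoffProfile_half_eq win v)
  rw [heq]
  have hj : Continuous (fun p : ℝ × ℝ ↦ profileC (2 * win.a) v p.2 * oscFactor p.1 p.2) :=
    ((continuous_profileC _ v).comp continuous_snd).mul continuous_oscFactor_uncurry
  exact intervalIntegral.continuous_parametric_intervalIntegral_of_continuous' hj _ _

/-! ## §4 Integrability of the archimedean integrand of `G ⋆ G̃` -/

/-- **The archimedean integrand of the autocorrelation of the cut-off profile is integrable**:
hypothesis `hA` of `WeilContinuous.tendsto_weilFunctional_moll` / `tendsto_weilArchIntegral_moll`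
for `g := cutoffProfile win v ⋆ (cutoffProfile win v)~`. [folklore] -/
theorem integrable_weilArchIntegrand_cutoffProfile (win : Window) (v : Fin (win.N + 1) → ℝ) :
    Integrable fun t : ℝ ↦
      weilMellin (weilConv (cutoffProfile win v) (weilReflect (cutoffProfile win v))) (1 / 2 + t * I) *
        ((Complex.digamma (1 / 4 + t / 2 * I)).re : ℂ) := by
  set G := cutoffProfile win v with hG
  obtain ⟨C, hC0, hC⟩ := exists_norm_weilMellin_cutoffProfile_half_le win v
  -- `‖Re ψ(¼ + it/2)‖ ≤ D + log(1 + |t|)` (digamma majorant of the tree; kept local: the same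
  -- statement is landed in another route's module, gate lint `dedup.landed` p187771)
  obtain ⟨D, hD0, hD⟩ : ∃ D : ℝ, 0 ≤ D ∧
      ∀ t : ℝ, ‖((Complex.digamma (1 / 4 + t / 2 * I)).re : ℂ)‖ ≤ D + Real.log (1 + |t|) := by
    obtain ⟨C, hC⟩ :=
      Literature.Analysis.SpecialFunctions.Complex.exists_norm_digamma_vertical_le
        (a := 1 / 4) (by norm_num)
    have hw : ∀ t : ℝ, (1 / 4 : ℂ) + (t : ℂ) / 2 * I = ((1 / 4 : ℝ) : ℂ) + ((t / 2 : ℝ) : ℂ) * I := by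
      intro t; push_cast; ring
    have hC0 : 0 ≤ C := by
      have h := hC 0
      simp only [abs_zero, add_zero, Real.log_one] at h
      exact (norm_nonneg _).trans (by simpa using h)
    refine ⟨C, hC0, fun t ↦ ?_⟩
    have h1 : ‖((Complex.digamma (1 / 4 + t / 2 * I)).re : ℂ)‖ ≤
        ‖Complex.digamma (1 / 4 + t / 2 * I)‖ := by
      rw [Complex.norm_real, Real.norm_eq_abs]
      exact Complex.abs_re_le_norm _
    have h2 := hC (t / 2)
    rw [← hw t] at h2
    have h3 : Real.log (1 + |t / 2|) ≤ Real.log (1 + |t|) := by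
      refine Real.log_le_log (by positivity) ?_
      rw [abs_div, abs_two]
      linarith [abs_nonneg t]
    linarith
  -- majorant `K (1 + |t|)^{-3/2}`
  set K : ℝ := C ^ 2 * (D + 2) with hK
  have hmaj : Integrable fun t : ℝ ↦ K * (1 + ‖t‖) ^ (-(3 / 2 : ℝ)) :=
    (integrable_one_add_norm (E := ℝ) (μ := volume) (r := 3 / 2)
      (by rw [Module.finrank_self]; norm_num)).const_mul K
  refine hmaj.mono' ?_ (Eventually.of_forall fun t ↦ ?_)
  · -- measurability: product of two continuous functions (`Re ψ(¼+it/2)` is continuous since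
    -- `ψ` is continuous on `Re w > 0`; kept local: the statement is landed in another route's module)
    have hψc : Continuous fun t : ℝ ↦ ((Complex.digamma (1 / 4 + t / 2 * I)).re : ℂ) := by
      have hw : ∀ t : ℝ, (1 / 4 : ℂ) + (t : ℂ) / 2 * I = ((1 / 4 : ℝ) : ℂ) + ((t / 2 : ℝ) : ℂ) * I := by
        intro t; push_cast; ring
      refine continuous_ofReal.comp (Complex.continuous_re.comp ?_)
      refine Literature.Analysis.SpecialFunctions.Complex.continuousOn_digamma.comp_continuous
        (by fun_prop) fun t ↦ ?_
      rw [hw t]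
      simp
    have h1 : Continuous fun t : ℝ ↦ weilMellin (weilConv G (weilReflect G)) (1 / 2 + t * I) := by
      have heq : (fun t : ℝ ↦ weilMellin (weilConv G (weilReflect G)) (1 / 2 + t * I)) =
          fun t : ℝ ↦ (Complex.normSq (weilMellin G (1 / 2 + t * I)) : ℂ) :=
        funext fun t ↦ weilMellin_autocorr_half (integrable_cutoffProfile win v) t
      rw [heq]
      exact continuous_ofReal.comp
        (Complex.continuous_normSq.comp (continuous_weilMellin_cutoffProfile_half win v))
    exact (h1.mul hψc).aestronglyMeasurable
  · -- the bound
    rw [norm_mul, norm_weilMellin_autocorr_half (integrable_cutoffProfile win v)]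
    have hu : 0 < 1 + |t| := by positivity
    have hGt : ‖weilMellin G (1 / 2 + t * I)‖ ≤ C / (1 + |t|) := hC t
    have hψ : ‖((Complex.digamma (1 / 4 + t / 2 * I)).re : ℂ)‖ ≤ (D + 2) * (1 + |t|) ^ (1 / 2 : ℝ) := by
      have hs1 : 1 ≤ (1 + |t|) ^ (1 / 2 : ℝ) :=
        Real.one_le_rpow (by linarith [abs_nonneg t]) (by norm_num)
      calc ‖((Complex.digamma (1 / 4 + t / 2 * I)).re : ℂ)‖ ≤ D + Real.log (1 + |t|) := hD t
        _ ≤ D * (1 + |t|) ^ (1 / 2 : ℝ) + 2 * (1 + |t|) ^ (1 / 2 : ℝ) := by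
            have hlog : Real.log (1 + |t|) ≤ 2 * (1 + |t|) ^ (1 / 2 : ℝ) := by
              have h := Real.log_le_rpow_div (x := 1 + |t|) (ε := 1 / 2) (by positivity)
                (by norm_num)
              calc Real.log (1 + |t|) ≤ (1 + |t|) ^ (1 / 2 : ℝ) / (1 / 2) := h
                _ = 2 * (1 + |t|) ^ (1 / 2 : ℝ) := by ring
            nlinarith
        _ = (D + 2) * (1 + |t|) ^ (1 / 2 : ℝ) := by ring
    have hsq : ‖weilMellin G (1 / 2 + t * I)‖ ^ 2 ≤ (C / (1 + |t|)) ^ 2 :=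
      pow_le_pow_left₀ (norm_nonneg _) hGt 2
    have hrpow : (C / (1 + |t|)) ^ 2 * ((D + 2) * (1 + |t|) ^ (1 / 2 : ℝ)) =
        K * (1 + ‖t‖) ^ (-(3 / 2 : ℝ)) := by
      rw [Real.norm_eq_abs, hK, div_pow]
      have hu' : (1 + |t|) ^ 2 = (1 + |t|) ^ (2 : ℝ) := by norm_cast
      rw [hu']
      have e1 : (1 + |t|) ^ (-(3 / 2 : ℝ)) = (1 + |t|) ^ (1 / 2 : ℝ) / (1 + |t|) ^ (2 : ℝ) := by
        rw [← Real.rpow_sub hu]; norm_num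
      rw [e1]
      field_simp
    calc ‖weilMellin G (1 / 2 + t * I)‖ ^ 2 * ‖((Complex.digamma (1 / 4 + t / 2 * I)).re : ℂ)‖
        ≤ (C / (1 + |t|)) ^ 2 * ((D + 2) * (1 + |t|) ^ (1 / 2 : ℝ)) :=
          mul_le_mul hsq hψ (norm_nonneg _) (by positivity)
      _ = K * (1 + ‖t‖) ^ (-(3 / 2 : ℝ)) := hrpow

end Summit.RiemannHypothesis.RiemannHypothesis.Theorems.PfPersistence
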